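import Summits.MatrixMultiplication.OmegaCensus.SmallFormats.MatMul22nRankGF7Slack3NoTightPoint
import HarnessLib

/-!
# ω-census family (a): reduction of `R_𝔽₇(⟨2,2,n⟩) ≥ 3n + 5` (`n ≥ 68`) to the slack-4 X-cap statement `NoTightPoint7 4 208`

Cell `pub-omega` (unit `pub-omega-tensor-g14`), topic `Summits/MatrixMultiplication/OmegaCensus` (sub-folder `SmallFormats`).
Framing (verbatim): lottery ticket; floor = certified bounds/negative ranges. HONEST FRAMING: a CONDITIONAL reduction, not a bound:
`NoTightPoint7 4 208` ("the 1274 cap / row-plane rows of `xcapSys7s 4` have no integer point in `[0,4]^401` of total `≥ 208`", i.e. the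
census datum `M₇(4) ≤ 207`) implies `3n + 5 ≤ R_𝔽₇(⟨2,2,n⟩)` for every `n ≥ 68`, on top of the landed floor `3n + 4` (`n ≥ 51`,
`MatMul22nRankGF7Slack3NoTightPoint`). The census content is the single cell `n = 68` (`R ≥ 209`; for `n ≥ 69` the plain LP bound
`51·R ≥ 156·n` already gives `3n + 5`). The hypothesis is decided — negatively for the existence of a tight point, i.e. `NoTightPoint7 4 208`
holds — by the exact engine of `pub-omega-tensor-g14/METHOD-CONGRUENCE-g14.md` (torus coset-count patterns + hidden mod-7 congruences);
that decision is NOT yet a kernel theorem, so everything here stays conditional. Nothing here is progress on `ω`.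
-/

namespace Summit.MatrixMultiplication.OmegaCensus.SmallFormats

open Literature.Computability.AlgebraicComplexity

/-- **Reduction for the census cell `n = 68`.** `NoTightPoint7 4 208` (`M₇(4) ≤ 207`) implies `3n + 5 ≤ R_𝔽₇(⟨2,2,n⟩)` for every
`n ≥ 68` (one more than the landed `3n + 4`, `three_mul_add_four_le_tensorRank_matMulTensor_22n_gf7`; the cell is `n = 68`, `R ≥ 209`). -/
theorem three_mul_add_five_le_of_noTightPoint7 (H : NoTightPoint7 4 208) (n : ℕ) (hn : 68 ≤ n) :
    3 * n + 5 ≤ tensorRank (matMulTensor (ZMod 7) 2 2 n) :=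
  floor_succ_of_noTightPoint7 H n (by omega) (three_mul_add_four_le_tensorRank_matMulTensor_22n_gf7 n (by omega))

/-- The same reduction for all three orientations `⟨2,2,n⟩`, `⟨2,n,2⟩`, `⟨n,2,2⟩` (Bläser 2013, Lemma 5.5). -/
theorem three_mul_add_five_le_orientations_of_noTightPoint7 (H : NoTightPoint7 4 208) (n : ℕ) (hn : 68 ≤ n) :
    3 * n + 5 ≤ tensorRank (matMulTensor (ZMod 7) 2 2 n) ∧ 3 * n + 5 ≤ tensorRank (matMulTensor (ZMod 7) 2 n 2) ∧
      3 * n + 5 ≤ tensorRank (matMulTensor (ZMod 7) n 2 2) := by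
  refine ⟨three_mul_add_five_le_of_noTightPoint7 H n hn, ?_, ?_⟩
  · rw [(Blaser2013_lemma55 (ZMod 7) 2 n 2).1]; exact three_mul_add_five_le_of_noTightPoint7 H n hn
  · rw [(Blaser2013_lemma55 (ZMod 7) n 2 2).2.1]; exact three_mul_add_five_le_of_noTightPoint7 H n hn

/-- The cell itself, conditionally: `NoTightPoint7 4 208 → 209 ≤ R_𝔽₇(⟨2,2,68⟩)`. -/
theorem tensorRank_matMulTensor_2_2_68_gf7_ge_of_noTightPoint7 (H : NoTightPoint7 4 208) :
    209 ≤ tensorRank (matMulTensor (ZMod 7) 2 2 68) :=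
  three_mul_add_five_le_of_noTightPoint7 H 68 le_rfl

end Summit.MatrixMultiplication.OmegaCensus.SmallFormats
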